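import Summits.ValiantsHypothesis.ValiantsHypothesis.Theorems.LacunarySymmetroidMatrixDescartesCensusWindowN

/-!
# `MatrixDescartes` census — the ONE-SLACK NEWTON LEMMA, DISTINCT-root currency (fileable twin)

HONEST FRAMING.  Object-search cell `pub-symmetroid`, route crux `Theses.LacunarySymmetroid.MatrixDescartes`
(ledger item stmt-ValiantsHypothesis-18050).  Engine-3 g15's ONE-SLACK NEWTON LEMMA (INBOX 2026-08-25T08:06:24Z; READER
PASS referee g42, R1029) as a COROLLARY of the tree's THEOREM N′ `newton_window_of_alternating` (theory-2 g14 / engine-6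
g16 kernel), in the DISTINCT-root currency `#Z₊^{distinct}(f) = (f.roots.toFinset.filter (0<·)).card`:
`one_slack_newton_card`: `f = Σ_{t<n} c_t X^{e_t}` (`n ≥ 3`, `e` strictly increasing, all `c_t ≠ 0`) with EXACTLY ONE
adjacent sign repetition `c_k c_{k+1} > 0` and at least `n − 2` DISTINCT positive roots satisfies the weighted Newton row
(C25 row) at every adjacent triple whose centre is neither `k` nor `k+1`.  This covers a hypothetical (2,6) nineteen with
V = 19 (21 non-zero coefficients, one repetition, 19 distinct roots) and, with `n = 20`, the one-vanishing-coefficient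
case; the sub-case «V = 20 with a double root» needs the MULTIPLICITY form `one_slack_newton` / `newton_window_of_le_countP`
of `…CensusWindowNMult.lean` (kernel-checked in a combined scratch; filing waits on farm builds).  A NECESSARY condition on
hypothetical nineteens; no bound on `ζ_sym`, nothing on `DoorA26`/`DoorA34` (OPEN), the crux, or `VP ≠ VNP`.

[folklore] — the cell's elementary lemma (engine-3 g15) on top of THEOREM N′.
-/

-- `Summit.ValiantsHypothesis.ValiantsHypothesis.…` repeats a component by the D-0017 layout
-- (single-conjunct summit), which the `dupNamespace` linter flags; the name is mandated.
set_option linter.dupNamespace false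

namespace Summit.ValiantsHypothesis.ValiantsHypothesis.Theorems.LacunarySymmetroidMatrixDescartes.Census

open Polynomial Finset
open scoped BigOperators Polynomial

/-- **ONE-SLACK NEWTON LEMMA (engine-3 g15; READER PASS referee g42, R1029) — distinct-root kernel form.**  Let
`f = Σ_{t<n} c_t X^{e_t}` (`n ≥ 3`, `e` strictly increasing, all `c_t ≠ 0`) have EXACTLY ONE adjacent sign repetition,
at `k` (`c_k c_{k+1} > 0`, all other adjacent pairs alternating), and at least `n − 2` DISTINCT positive roots.  Then at
every adjacent triple `(i, i+1, i+2)` with centre `i + 1 ∉ {k, k+1}`: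
`(|c_i| W_i)^{e_{i+2}−e_{i+1}} · (|c_{i+2}| W_{i+2})^{e_{i+1}−e_i} ≤ (|c_{i+1}| W_{i+1})^{e_{i+2}−e_i}`,
`W_t = ∏_{u ≠ t} |e_t − e_u|` — the alternation count is `n − 2 ≤ #Z₊^{distinct}`, so THEOREM N′ applies. [folklore] -/
theorem one_slack_newton_card {n : ℕ} (hn : 3 ≤ n) (e : ℕ → ℕ) (he : StrictMono e) (c : ℕ → ℝ)
    (hc : ∀ t, t < n → c t ≠ 0) {k : ℕ} (hk : k + 1 < n) (hrep : 0 < c k * c (k + 1))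
    (halt : ∀ t, t + 1 < n → t ≠ k → c t * c (t + 1) < 0)
    (hZ : n - 2 ≤ ((∑ t ∈ range n, C (c t) * X ^ (e t) : ℝ[X]).roots.toFinset.filter (fun x => 0 < x)).card)
    {i : ℕ} (hi : i + 2 < n) (hik : i ≠ k) (hik' : i + 1 ≠ k) :
    (|c i| * ∏ u ∈ range n, (if u = i then 1 else |(e i : ℝ) - e u|)) ^ (e (i + 2) - e (i + 1)) *
      (|c (i + 2)| * ∏ u ∈ range n, (if u = i + 2 then 1 else |(e (i + 2) : ℝ) - e u|)) ^ (e (i + 1) - e i)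
    ≤ (|c (i + 1)| * ∏ u ∈ range n, (if u = i + 1 then 1 else |(e (i + 1) : ℝ) - e u|)) ^ (e (i + 2) - e i) := by
  -- the alternation count is exactly `n − 2`
  have hcount : (∑ t ∈ range (n - 1), (if c t * c (t + 1) < 0 then 1 else 0)) = n - 2 := by
    rw [Finset.sum_boole]
    have hfilter : (range (n - 1)).filter (fun t => c t * c (t + 1) < 0) = (range (n - 1)).erase k := by
      ext t
      simp only [Finset.mem_filter, Finset.mem_erase, Finset.mem_range]
      constructor
      · rintro ⟨ht, hlt⟩
        refine ⟨?_, ht⟩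
        rintro rfl
        linarith
      · rintro ⟨htk, ht⟩
        exact ⟨ht, halt t (by omega) htk⟩
    rw [hfilter, Finset.card_erase_of_mem (Finset.mem_range.mpr (by omega)), Finset.card_range]
    push_cast
    omega
  have hZ' : (∑ t ∈ range (n - 1), (if c t * c (t + 1) < 0 then 1 else 0)) ≤
      ((∑ t ∈ range n, C (c t) * X ^ (e t) : ℝ[X]).roots.toFinset.filter (fun x => 0 < x)).card := by
    rw [hcount]; exact hZ
  exact newton_window_of_alternating n hn e he c hc hZ' i hi (halt i (by omega) hik) (halt (i + 1) (by omega) hik')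

end Summit.ValiantsHypothesis.ValiantsHypothesis.Theorems.LacunarySymmetroidMatrixDescartes.Census
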